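import Literature.Topology.FourManifolds.GaussDiagramsRMoves
import HarnessLib

/-!
# The second Reidemeister move as a double insertion of chords at adjacent parameters

Companion of `GaussDiagramsInsertReading.lean` (combinatorial layer of the event analysis for the
named fact `Knot.reidemeisterR`, direction `→`). The constructors `PolyakMove.omega2a`
(co-oriented second move `Ω2a/Ω2b`) and `RMove.omega2c` (anti-parallel second move `Ω2c/Ω2d`)
of `GaussDiagrams.lean` / `GaussDiagramsRMoves.lean` apply to ANY double insertion
`(G.insertChord o u ε).insertChord o' u' (-ε)` whose two new over-passages, and two new
under-passages, occupy adjacent positions. When the positions carry strictly increasing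
parameters `θ₂` (a reading), adjacency of positions is an order condition on parameters: no
parameter lies strictly between (`Fin.val_eq_val_add_one_of_strictMono`). Hence
(`GaussDiagram.rMove_insertChord_insertChord`): if the two new over-parameters are consecutive
among all parameters and so are the two new under-parameters (in either order), the double
insertion is a move of `RMove`, in particular `REquiv`-alent to `G`. This is the form in which
the birth of a bigon through a self-tangency (second move) is recognised on the Gauss diagrams
read before and after the event.

## References

* M. Polyak, *Minimal generating sets of Reidemeister moves*, Quantum Topol. 1 (2010), §1,
  Fig. 2 (`Ω2a–d`). [Polyak2010]
* M. Goussarov, M. Polyak, O. Viro, *Finite-type invariants of classical and virtual knots*,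
  Topology 39 (2000), Fig. 3. [GPV2000]
-/

open Function Set

namespace Literature.Topology.FourManifolds

/-- **Adjacent positions from consecutive parameters.** If `θ` is strictly increasing,
`θ q < θ q'` and no parameter lies strictly between them, then `q' = q + 1` as natural numbers.
[folklore] -/
theorem Fin.val_eq_val_add_one_of_strictMono {m : ℕ} {θ : Fin m → ℝ} (hθ : StrictMono θ)
    {q q' : Fin m} (hlt : θ q < θ q') (hgap : ∀ r, θ q < θ r → θ q' ≤ θ r) :
    (q' : ℕ) = q + 1 := by
  have hqq' : q < q' := hθ.lt_iff_lt.1 hlt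
  have h1 : (q : ℕ) + 1 ≤ q' := hqq'
  by_contra hne
  have h2 : (q : ℕ) + 1 < q' := lt_of_le_of_ne h1 (Ne.symm hne)
  set r : Fin m := ⟨q + 1, lt_trans h2 q'.isLt⟩ with hr
  have hqr : q < r := Fin.lt_def.2 (by simp [hr])
  have hrq' : r < q' := Fin.lt_def.2 (by simpa [hr] using h2)
  exact absurd (hgap r (hθ hqr)) (not_le.2 (hθ hrq'))

namespace GaussDiagram

variable (G : GaussDiagram) (o : Fin (2 * G.n + 2)) (u : Fin (2 * G.n + 1))
  (o' : Fin (2 * (G.n + 1) + 2)) (u' : Fin (2 * (G.n + 1) + 1)) (ε : ℤˣ)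

/-- **The co-oriented second move from consecutive parameters.** Let `θ₂` be strictly
increasing parameters of the positions of the double insertion
`G₂ = (G.insertChord o u ε).insertChord o' u' (-ε)` (new chords `x = Fin.last n`, inserted
first, and `y = Fin.last (n + 1)`). If the over-parameter of `y` follows that of `x` with no
parameter in between, and likewise the under-parameter of `y` follows that of `x`, then
`G → G₂` is the move `PolyakMove.omega2a` (`Ω2a/Ω2b`). [cite: Polyak2010, §1] -/
theorem polyakMove_insertChord_insertChord {θ₂ : Fin (2 * (G.n + 1) + 2) → ℝ}
    (hθ₂ : StrictMono θ₂)
    (hov : θ₂ (((G.insertChord o u ε).insertChord o' u' (-ε)).overPos (Fin.last G.n).castSucc)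
      < θ₂ (((G.insertChord o u ε).insertChord o' u' (-ε)).overPos (Fin.last (G.n + 1))))
    (hov' : ∀ r, θ₂ (((G.insertChord o u ε).insertChord o' u' (-ε)).overPos
        (Fin.last G.n).castSucc) < θ₂ r →
      θ₂ (((G.insertChord o u ε).insertChord o' u' (-ε)).overPos (Fin.last (G.n + 1))) ≤ θ₂ r)
    (hun : θ₂ (((G.insertChord o u ε).insertChord o' u' (-ε)).underPos (Fin.last G.n).castSucc)
      < θ₂ (((G.insertChord o u ε).insertChord o' u' (-ε)).underPos (Fin.last (G.n + 1))))
    (hun' : ∀ r, θ₂ (((G.insertChord o u ε).insertChord o' u' (-ε)).underPos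
        (Fin.last G.n).castSucc) < θ₂ r →
      θ₂ (((G.insertChord o u ε).insertChord o' u' (-ε)).underPos (Fin.last (G.n + 1))) ≤ θ₂ r) :
    PolyakMove G ((G.insertChord o u ε).insertChord o' u' (-ε)) :=
  PolyakMove.omega2a G o u o' u' ε (Fin.val_eq_val_add_one_of_strictMono hθ₂ hov hov')
    (Fin.val_eq_val_add_one_of_strictMono hθ₂ hun hun')

/-- **The anti-parallel second move from consecutive parameters.** As above, but the
under-parameter of `x` follows that of `y`: then `G → G₂` is the move `RMove.omega2c`
(`Ω2c/Ω2d`). [cite: Polyak2010, §1] -/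
theorem rMove_insertChord_insertChord_anti {θ₂ : Fin (2 * (G.n + 1) + 2) → ℝ}
    (hθ₂ : StrictMono θ₂)
    (hov : θ₂ (((G.insertChord o u ε).insertChord o' u' (-ε)).overPos (Fin.last G.n).castSucc)
      < θ₂ (((G.insertChord o u ε).insertChord o' u' (-ε)).overPos (Fin.last (G.n + 1))))
    (hov' : ∀ r, θ₂ (((G.insertChord o u ε).insertChord o' u' (-ε)).overPos
        (Fin.last G.n).castSucc) < θ₂ r →
      θ₂ (((G.insertChord o u ε).insertChord o' u' (-ε)).overPos (Fin.last (G.n + 1))) ≤ θ₂ r)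
    (hun : θ₂ (((G.insertChord o u ε).insertChord o' u' (-ε)).underPos (Fin.last (G.n + 1)))
      < θ₂ (((G.insertChord o u ε).insertChord o' u' (-ε)).underPos (Fin.last G.n).castSucc))
    (hun' : ∀ r, θ₂ (((G.insertChord o u ε).insertChord o' u' (-ε)).underPos
        (Fin.last (G.n + 1))) < θ₂ r →
      θ₂ (((G.insertChord o u ε).insertChord o' u' (-ε)).underPos (Fin.last G.n).castSucc) ≤ θ₂ r) :
    RMove G ((G.insertChord o u ε).insertChord o' u' (-ε)) :=
  RMove.omega2c G o u o' u' ε (Fin.val_eq_val_add_one_of_strictMono hθ₂ hov hov')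
    (Fin.val_eq_val_add_one_of_strictMono hθ₂ hun hun')

/-- **The second Reidemeister move on Gauss diagrams, read from parameters**: with the two new
over-parameters consecutive and the two new under-parameters consecutive in either order, the
double insertion is a move of `RMove` — `Ω2a/Ω2b` (co-oriented) or `Ω2c/Ω2d` (anti-parallel) —
hence `G` and `G₂` are `REquiv`-alent. [cite: Polyak2010, §1] -/
theorem rEquiv_insertChord_insertChord {θ₂ : Fin (2 * (G.n + 1) + 2) → ℝ}
    (hθ₂ : StrictMono θ₂)
    (hov : θ₂ (((G.insertChord o u ε).insertChord o' u' (-ε)).overPos (Fin.last G.n).castSucc)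
      < θ₂ (((G.insertChord o u ε).insertChord o' u' (-ε)).overPos (Fin.last (G.n + 1))))
    (hov' : ∀ r, θ₂ (((G.insertChord o u ε).insertChord o' u' (-ε)).overPos
        (Fin.last G.n).castSucc) < θ₂ r →
      θ₂ (((G.insertChord o u ε).insertChord o' u' (-ε)).overPos (Fin.last (G.n + 1))) ≤ θ₂ r)
    (hun : (θ₂ (((G.insertChord o u ε).insertChord o' u' (-ε)).underPos (Fin.last G.n).castSucc)
        < θ₂ (((G.insertChord o u ε).insertChord o' u' (-ε)).underPos (Fin.last (G.n + 1))) ∧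
      ∀ r, θ₂ (((G.insertChord o u ε).insertChord o' u' (-ε)).underPos
          (Fin.last G.n).castSucc) < θ₂ r →
        θ₂ (((G.insertChord o u ε).insertChord o' u' (-ε)).underPos (Fin.last (G.n + 1))) ≤ θ₂ r)
      ∨ (θ₂ (((G.insertChord o u ε).insertChord o' u' (-ε)).underPos (Fin.last (G.n + 1)))
        < θ₂ (((G.insertChord o u ε).insertChord o' u' (-ε)).underPos (Fin.last G.n).castSucc) ∧
      ∀ r, θ₂ (((G.insertChord o u ε).insertChord o' u' (-ε)).underPos
          (Fin.last (G.n + 1))) < θ₂ r →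
        θ₂ (((G.insertChord o u ε).insertChord o' u' (-ε)).underPos (Fin.last G.n).castSucc)
          ≤ θ₂ r)) :
    G.REquiv ((G.insertChord o u ε).insertChord o' u' (-ε)) := by
  rcases hun with ⟨hun, hun''⟩ | ⟨hun, hun''⟩
  · exact (RMove.polyak (G.polyakMove_insertChord_insertChord o u o' u' ε hθ₂ hov hov' hun
      hun'')).rEquiv
  · exact (G.rMove_insertChord_insertChord_anti o u o' u' ε hθ₂ hov hov' hun hun'').rEquiv

end GaussDiagram

end Literature.Topology.FourManifolds
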